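import Summits.SmoothPoincare4.SmoothPoincare4.Theorems.ConvexBisectionAcyclicBisectionExistsBeltMonodromySlope
import HarnessLib

/-!
# N1 ▸ `node_N1_move` ▸ (d) N1-mono, brick H4-7: THE BELT SLOPE ON A UNIFORM BELT —
# non-vanishing fibre derivative and the Lipschitz bound `|Sl (u, m)| ≤ C ‖m‖`
(wave 7, crux stmt-SmoothPoincare4-10508, line `modp-braid-orbits`, registered stub `stub_M2geo` (N1) ▸
`node_N1_move` ▸ sub-node (d); registered sub-goal `helper_beltSlope_uniformBelt`)

Continuation of `…BeltMonodromySlope.lean` (piece (d4′) of H4-REPORT §4).  For the belt slope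
`Sl (u, m) := S_{d k} (w (Ψ (∂(G₀⁻¹) (β♭ (e^{2πiu}, m)))))` of handle `k` in the telescope of `node_N1_move`
(`beltSlope_package`: smooth on `ℝ × ball 0 ρ`, `Sl (u, 0) = 0`, differential `(δu, δm) ↦ ⟪M e^{2πiu}, δm⟫` at the
belt circle, `M` injective) we prove, on a UNIFORM thinner belt `ℝ × ball 0 ρ'`:
* §1 the FIBRE derivative `∂_m Sl (u, m)` does not vanish (it is `⟪M e^{2πiu}, ·⟫ ≠ 0` at `m = 0`; continuity of
  `fderiv`, `1`-periodicity in `u`, generalized tube lemma) — the pages of `∂X` cross every fibre disc of the belt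
  solid torus transversally, so the field `∇_m Sl / ‖∇_m Sl‖²` of piece (d6) is defined;
* §2 the LIPSCHITZ BOUND `|Sl (u, m)| ≤ C ‖m‖` (mean value inequality on the fibre discs with a uniform bound of
  `‖∂_m Sl‖` on `[0,1] × closedBall 0 ρ'`) — the core zone `{‖m‖ < ρ₁}` lies inside the levels `|σ| < C ρ₁`
  (the choice `η ≥ 2 C ρ₁` of piece (d6)).
Registered packaging: `helper_beltSlope_uniformBelt`.  Everything is proved; no named facts, no `sorry`.
References: J. B. Etnyre, T. Fuller, IMRN 2006, Thm. 1 (proof, p. 8) [EtnyreFuller2006]; A. A. Kosinski,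
*Differential Manifolds* (1993), VI §6 [Kosinski1993].
-/

noncomputable section

set_option linter.dupNamespace false

open scoped Manifold ContDiff Topology ComplexConjugate
open Set Function Metric Complex Filter
open Literature.Topology.FourManifolds Literature.Topology.FourManifolds.HandleAttachingMap
  Literature.Topology.FourManifolds.LefschetzBase

namespace Summit.SmoothPoincare4.SmoothPoincare4.Theorems.AcyclicBisectionExists.ModpBraidOrbits

/-! ## §1 Uniform belts for `1`-periodic open conditions -/

/-- **A `1`-periodic open condition holding on the core `ℝ × {0}` holds on a uniform belt `ℝ × ball 0 ρ'`.**
[folklore] -/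
theorem exists_uniform_belt {P : ℝ × EuclideanSpace ℝ (Fin 2) → Prop} {ρ : ℝ} (hρ : 0 < ρ)
    (hP : IsOpen {p : ℝ × EuclideanSpace ℝ (Fin 2) | p ∈ (univ : Set ℝ) ×ˢ ball (0 : EuclideanSpace ℝ (Fin 2)) ρ ∧ P p})
    (h0 : ∀ u : ℝ, P (u, 0)) (h1 : ∀ u m, P (u + 1, m) ↔ P (u, m)) :
    ∃ ρ' : ℝ, 0 < ρ' ∧ ρ' ≤ ρ ∧ ∀ (u : ℝ) (m : EuclideanSpace ℝ (Fin 2)), ‖m‖ < ρ' → P (u, m) := by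
  have hsub : Icc (0 : ℝ) 1 ×ˢ ({(0 : EuclideanSpace ℝ (Fin 2))} : Set (EuclideanSpace ℝ (Fin 2))) ⊆
      {p : ℝ × EuclideanSpace ℝ (Fin 2) | p ∈ (univ : Set ℝ) ×ˢ ball (0 : EuclideanSpace ℝ (Fin 2)) ρ ∧ P p} := by
    rintro ⟨u, m⟩ ⟨-, hm⟩
    rw [mem_singleton_iff] at hm
    subst hm
    exact ⟨⟨mem_univ _, by simp [hρ]⟩, h0 u⟩
  obtain ⟨A, B, -, hBo, hA, hB, hAB⟩ := generalized_tube_lemma isCompact_Icc isCompact_singleton hP hsub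
  obtain ⟨ρ₀, hρ₀, hball⟩ := Metric.isOpen_iff.1 hBo 0 (hB (mem_singleton _))
  refine ⟨min ρ₀ ρ, lt_min hρ₀ hρ, min_le_right _ _, fun u m hm => ?_⟩
  have hmB : m ∈ B := hball (mem_ball_zero_iff.2 (lt_of_lt_of_le hm (min_le_left _ _)))
  have hper : ∀ n : ℕ, ∀ u, P (u + n, m) ↔ P (u, m) := by
    intro n
    induction n with
    | zero => intro u; simp
    | succ n ih => intro u; rw [Nat.cast_succ, ← add_assoc, h1, ih]
  have hperZ : ∀ n : ℤ, ∀ u, P (u + n, m) ↔ P (u, m) := by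
    intro n u
    obtain ⟨k, rfl | rfl⟩ := n.eq_nat_or_neg
    · exact_mod_cast hper k u
    · have := hper k (u + (-(k : ℤ) : ℤ))
      push_cast at this ⊢
      rw [show u + -(k : ℝ) + k = u by ring] at this
      exact this.symm
  have e : P (Int.fract u, m) ↔ P (u, m) := by
    rw [Int.fract]
    have := hperZ (-⌊u⌋) u
    push_cast at this
    rwa [← sub_eq_add_neg] at this
  exact e.1 (hAB (mk_mem_prod (hA ⟨Int.fract_nonneg u, (Int.fract_lt_one u).le⟩) hmB)).2

/-! ## §2 The fibre derivative of the belt slope does not vanish on a uniform belt; the Lipschitz bound -/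

section Belt

variable {g n : ℕ} {h : Fin n → HandleAttachingMap 3 2 (Base g)}
  {X₀ : Type} [TopologicalSpace X₀] [ChartedSpace (EuclideanHalfSpace 4) X₀]
  (bX : BoundaryData (𝓡∂ 4) X₀ (𝓡 3)) (Ψ : bX.carrier ≃ₘ⟮𝓡 3, 𝓡 3⟯ (bBase g).carrier)
  {X : Type} [TopologicalSpace X] [ChartedSpace (EuclideanHalfSpace 4) X] [IsManifold (𝓡∂ 4) ∞ X]
  (G₀ : X₀ ≃ₘ⟮𝓡∂ 4, 𝓡∂ 4⟯ X) (D : MultiAttachmentData h (𝓡∂ 4) X) (d : Fin n → ℂ) (k : Fin n)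

/-- **The belt slope on a uniform belt** (brick H4-7; piece (d4′)).  Under the hypotheses of `beltSlope_package`
there are `0 < ρ' ≤ 1`, `C ≥ 0` and an injective `M` such that on `ℝ × ball 0 ρ'` the belt slope `Sl` is smooth
with POSITIVE denominator, its fibre derivative `∂_m Sl (u, m) = (fderiv Sl (u,m)) ∘ inr` never vanishes, it
vanishes on the belt circle with differential `(δu, δm) ↦ ⟪M e^{2πiu}, δm⟫` there, and `|Sl (u, m)| ≤ C ‖m‖`
(fibre derivative in the partial form `fderiv (m' ↦ Sl (u, m')) m ≠ 0`).
[cite: EtnyreFuller2006, Thm. 1 (proof, p. 8)] -/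
theorem beltSlope_uniformBelt (hd : ‖d k‖ = 1) (hcore : ∀ θ, (h k).attachingCircle θ ∈ page g (d k))
    (hseam : ∀ (y : bX.carrier) (a : ↥(coresComplement h)), G₀ (bX.incl y) = D.jA a →
      ∃ c : ℝ, 0 < c ∧ w g ((bBase g).incl (Ψ y)).1 = (c : ℂ) * w g (a : Base g).1)
    (hbelt : ∀ (y : bX.carrier) (j : Fin n) (b : ↥(beltPiece 3 2)), G₀ (bX.incl y) = D.jB j b →
      G₀ (bX.incl y) ∉ range D.jA →
      ∃ c : ℝ, 0 < c ∧ w g ((bBase g).incl (Ψ y)).1 = (c : ℂ) * d j) :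
    ∃ (ρ' C : ℝ) (M : EuclideanSpace ℝ (Fin 2) →L[ℝ] EuclideanSpace ℝ (Fin 2)), 0 < ρ' ∧ ρ' ≤ 1 ∧ 0 ≤ C ∧ Injective M ∧
      (∀ (u : ℝ) (m : EuclideanSpace ℝ (Fin 2)), ‖m‖ < ρ' →
        0 < (conj (d k) * w g ((bBase g).incl (Ψ ((BoundaryManifold.boundaryData 3 X).restrictDiffeomorph bX G₀.symm
          ((beltMap D k).boundaryTube.toHomeo (circlePt u, m))))).1).re) ∧
      ContDiffOn ℝ ∞ (fun p : ℝ × EuclideanSpace ℝ (Fin 2) =>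
        (conj (d k) * w g ((bBase g).incl (Ψ ((BoundaryManifold.boundaryData 3 X).restrictDiffeomorph bX G₀.symm
          ((beltMap D k).boundaryTube.toHomeo (circlePt p.1, p.2))))).1).im /
        (conj (d k) * w g ((bBase g).incl (Ψ ((BoundaryManifold.boundaryData 3 X).restrictDiffeomorph bX G₀.symm
          ((beltMap D k).boundaryTube.toHomeo (circlePt p.1, p.2))))).1).re)
        ((univ : Set ℝ) ×ˢ ball (0 : EuclideanSpace ℝ (Fin 2)) ρ') ∧
      (∀ (u : ℝ) (m : EuclideanSpace ℝ (Fin 2)), ‖m‖ < ρ' →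
        fderiv ℝ (fun m' : EuclideanSpace ℝ (Fin 2) =>
          (conj (d k) * w g ((bBase g).incl (Ψ ((BoundaryManifold.boundaryData 3 X).restrictDiffeomorph bX G₀.symm
            ((beltMap D k).boundaryTube.toHomeo (circlePt u, m'))))).1).im /
          (conj (d k) * w g ((bBase g).incl (Ψ ((BoundaryManifold.boundaryData 3 X).restrictDiffeomorph bX G₀.symm
            ((beltMap D k).boundaryTube.toHomeo (circlePt u, m'))))).1).re) m ≠ 0) ∧
      (∀ u : ℝ, HasFDerivAt (fun p : ℝ × EuclideanSpace ℝ (Fin 2) =>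
          (conj (d k) * w g ((bBase g).incl (Ψ ((BoundaryManifold.boundaryData 3 X).restrictDiffeomorph bX G₀.symm
            ((beltMap D k).boundaryTube.toHomeo (circlePt p.1, p.2))))).1).im /
          (conj (d k) * w g ((bBase g).incl (Ψ ((BoundaryManifold.boundaryData 3 X).restrictDiffeomorph bX G₀.symm
            ((beltMap D k).boundaryTube.toHomeo (circlePt p.1, p.2))))).1).re)
        ((innerSL ℝ (M (circlePt u : EuclideanSpace ℝ (Fin 2)))).comp
          (ContinuousLinearMap.snd ℝ ℝ (EuclideanSpace ℝ (Fin 2)))) (u, 0)) ∧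
      (∀ (u : ℝ) (m : EuclideanSpace ℝ (Fin 2)), ‖m‖ < ρ' →
        |(conj (d k) * w g ((bBase g).incl (Ψ ((BoundaryManifold.boundaryData 3 X).restrictDiffeomorph bX G₀.symm
            ((beltMap D k).boundaryTube.toHomeo (circlePt u, m))))).1).im /
          (conj (d k) * w g ((bBase g).incl (Ψ ((BoundaryManifold.boundaryData 3 X).restrictDiffeomorph bX G₀.symm
            ((beltMap D k).boundaryTube.toHomeo (circlePt u, m))))).1).re| ≤ C * ‖m‖) := by
  obtain ⟨ρ, M, hρ, hρ1, hMi, hre, hSl, him0, hM⟩ := beltSlope_package g n h X₀ bX Ψ X G₀ D d k hd hcore hseam hbelt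
  -- the slope as an opaque function
  obtain ⟨Sl, hSl_def⟩ : ∃ Sl : ℝ × EuclideanSpace ℝ (Fin 2) → ℝ, ∀ p, Sl p =
      (conj (d k) * w g ((bBase g).incl (Ψ ((BoundaryManifold.boundaryData 3 X).restrictDiffeomorph bX G₀.symm
        ((beltMap D k).boundaryTube.toHomeo (circlePt p.1, p.2))))).1).im /
      (conj (d k) * w g ((bBase g).incl (Ψ ((BoundaryManifold.boundaryData 3 X).restrictDiffeomorph bX G₀.symm
        ((beltMap D k).boundaryTube.toHomeo (circlePt p.1, p.2))))).1).re := ⟨_, fun _ => rfl⟩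
  have hSl_eq : (fun p : ℝ × EuclideanSpace ℝ (Fin 2) =>
      (conj (d k) * w g ((bBase g).incl (Ψ ((BoundaryManifold.boundaryData 3 X).restrictDiffeomorph bX G₀.symm
        ((beltMap D k).boundaryTube.toHomeo (circlePt p.1, p.2))))).1).im /
      (conj (d k) * w g ((bBase g).incl (Ψ ((BoundaryManifold.boundaryData 3 X).restrictDiffeomorph bX G₀.symm
        ((beltMap D k).boundaryTube.toHomeo (circlePt p.1, p.2))))).1).re) = Sl :=
    funext fun p => (hSl_def p).symm
  rw [hSl_eq] at hSl hM ⊢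
  have hSl1 : ∀ u m, Sl (u + 1, m) = Sl (u, m) := fun u m => by rw [hSl_def, hSl_def]; simp only [circlePt_add_one]
  have hSl0 : ∀ u : ℝ, Sl (u, 0) = 0 := fun u => by
    rw [hSl_def]; show _ / _ = 0; rw [him0 u, zero_div]
  -- the open belt, differentiability and continuity of `fderiv Sl` there
  set U : Set (ℝ × EuclideanSpace ℝ (Fin 2)) := (univ : Set ℝ) ×ˢ ball (0 : EuclideanSpace ℝ (Fin 2)) ρ with hU
  have hUo : IsOpen U := isOpen_univ.prod isOpen_ball
  have hcont : ContinuousOn (fun p => fderiv ℝ Sl p) U := hSl.continuousOn_fderiv_of_isOpen hUo (by simp)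
  have hdiffU : ∀ p ∈ U, HasFDerivAt Sl (fderiv ℝ Sl p) p := fun p hp =>
    ((hSl.differentiableOn (by simp)).differentiableAt (hUo.mem_nhds hp)).hasFDerivAt
  -- the fibre derivative is `(fderiv Sl p) ∘ inr` on `U`
  have hfib : ∀ p ∈ U, HasFDerivAt (fun m' : EuclideanSpace ℝ (Fin 2) => Sl (p.1, m'))
      ((fderiv ℝ Sl p).comp (ContinuousLinearMap.inr ℝ ℝ (EuclideanSpace ℝ (Fin 2)))) p.2 := fun p hp =>
    (hdiffU p hp).comp p.2 (hasFDerivAt_prodMk_right p.1 p.2)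
  -- (1) the fibre derivative does not vanish near the core
  set Pn : ℝ × EuclideanSpace ℝ (Fin 2) → Prop := fun p =>
    fderiv ℝ (fun m' : EuclideanSpace ℝ (Fin 2) => Sl (p.1, m')) p.2 ≠ 0 with hPn
  have hPn_open : IsOpen {p : ℝ × EuclideanSpace ℝ (Fin 2) | p ∈ (univ : Set ℝ) ×ˢ ball (0 : EuclideanSpace ℝ (Fin 2)) ρ ∧ Pn p} := by
    have h1 : ContinuousOn (fun p => (fderiv ℝ Sl p).comp (ContinuousLinearMap.inr ℝ ℝ (EuclideanSpace ℝ (Fin 2)))) U :=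
      hcont.clm_comp continuousOn_const
    have h2 := h1.isOpen_inter_preimage hUo isOpen_compl_singleton (t := ({0}ᶜ : Set (EuclideanSpace ℝ (Fin 2) →L[ℝ] ℝ)))
    have e : {p : ℝ × EuclideanSpace ℝ (Fin 2) | p ∈ (univ : Set ℝ) ×ˢ ball (0 : EuclideanSpace ℝ (Fin 2)) ρ ∧ Pn p} =
        U ∩ (fun p => (fderiv ℝ Sl p).comp (ContinuousLinearMap.inr ℝ ℝ (EuclideanSpace ℝ (Fin 2)))) ⁻¹'
          ({0}ᶜ : Set (EuclideanSpace ℝ (Fin 2) →L[ℝ] ℝ)) := by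
      ext p
      simp only [mem_setOf_eq, mem_inter_iff, mem_preimage, mem_compl_iff, mem_singleton_iff, hPn]
      constructor
      · rintro ⟨hp, hP⟩; exact ⟨hp, by rwa [(hfib p hp).fderiv] at hP⟩
      · rintro ⟨hp, hP⟩; exact ⟨hp, by rwa [(hfib p hp).fderiv]⟩
    rw [e]; exact h2
  have hPn0 : ∀ u : ℝ, Pn (u, 0) := fun u => by
    have hu0 : ((u, (0 : EuclideanSpace ℝ (Fin 2))) : ℝ × EuclideanSpace ℝ (Fin 2)) ∈ U := ⟨mem_univ _, by simp [hρ]⟩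
    show fderiv ℝ (fun m' : EuclideanSpace ℝ (Fin 2) => Sl (u, m')) 0 ≠ 0
    rw [(hfib _ hu0).fderiv]
    show (fderiv ℝ Sl (u, 0)).comp _ ≠ 0
    rw [(hM u).fderiv]
    intro h0
    have hθ : (circlePt u : EuclideanSpace ℝ (Fin 2)) ≠ 0 := by
      intro h; have := norm_eq_of_mem_sphere (circlePt u); rw [h, norm_zero] at this; exact zero_ne_one this
    have hMθ : M (circlePt u : EuclideanSpace ℝ (Fin 2)) ≠ 0 := fun h => hθ (hMi (h.trans (map_zero M).symm))
    have h1 := congrArg (fun T : EuclideanSpace ℝ (Fin 2) →L[ℝ] ℝ => T (M (circlePt u : EuclideanSpace ℝ (Fin 2)))) h0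
    have h2 : inner ℝ (M (circlePt u : EuclideanSpace ℝ (Fin 2))) (M (circlePt u : EuclideanSpace ℝ (Fin 2))) = 0 := h1
    rw [real_inner_self_eq_norm_sq] at h2
    exact hMθ (by simpa using h2)
  have hPn1 : ∀ u m, Pn (u + 1, m) ↔ Pn (u, m) := fun u m => by
    have e : (fun m' : EuclideanSpace ℝ (Fin 2) => Sl (u + 1, m')) = fun m' => Sl (u, m') := funext fun m' => hSl1 u m'
    show fderiv ℝ (fun m' : EuclideanSpace ℝ (Fin 2) => Sl (u + 1, m')) m ≠ 0 ↔ fderiv ℝ (fun m' => Sl (u, m')) m ≠ 0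
    rw [e]
  obtain ⟨ρ₁, hρ₁, hρ₁ρ, hPn_belt⟩ := exists_uniform_belt hρ hPn_open hPn0 hPn1
  -- (2) a uniform bound of `fderiv Sl` on `[0,1] × closedBall 0 (ρ₁/2)`, and the Lipschitz bound
  have hK : IsCompact (Icc (0 : ℝ) 1 ×ˢ closedBall (0 : EuclideanSpace ℝ (Fin 2)) (ρ₁ / 2)) :=
    isCompact_Icc.prod (isCompact_closedBall _ _)
  have hKU : Icc (0 : ℝ) 1 ×ˢ closedBall (0 : EuclideanSpace ℝ (Fin 2)) (ρ₁ / 2) ⊆ U := by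
    rintro ⟨u, m⟩ ⟨-, hm⟩
    refine ⟨mem_univ _, mem_ball_zero_iff.2 ?_⟩
    have := mem_closedBall_zero_iff.1 hm
    linarith
  obtain ⟨C, hC0, hCb⟩ := (hK.image_of_continuousOn ((continuous_norm.comp_continuousOn hcont).mono hKU)).isBounded.subset_closedBall_lt 0 0
  have hbound : ∀ u ∈ Icc (0 : ℝ) 1, ∀ m ∈ closedBall (0 : EuclideanSpace ℝ (Fin 2)) (ρ₁ / 2),
      ‖fderiv ℝ Sl (u, m)‖ ≤ C := by
    intro u hu m hm
    have hmem : ‖fderiv ℝ Sl (u, m)‖ ∈ closedBall (0 : ℝ) C := hCb (mem_image_of_mem _ (mk_mem_prod hu hm))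
    rw [mem_closedBall, dist_zero_right, Real.norm_eq_abs, abs_of_nonneg (norm_nonneg _)] at hmem
    exact hmem
  have hLip : ∀ (u : ℝ) (m : EuclideanSpace ℝ (Fin 2)), ‖m‖ < ρ₁ / 2 → |Sl (u, m)| ≤ C * ‖m‖ := by
    intro u m hm
    -- reduce to `u ∈ [0, 1)` by periodicity
    have eper : Sl (u, m) = Sl (Int.fract u, m) := by
      have hper : Function.Periodic (fun u => Sl (u, m)) 1 := fun u => hSl1 u m
      have h := (hper.int_mul (-⌊u⌋)) u
      simp only [Int.cast_neg, mul_one] at h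
      rw [Int.fract, sub_eq_add_neg]
      exact h.symm
    rw [eper]
    set u₀ := Int.fract u with hu₀
    have hu₀mem : u₀ ∈ Icc (0 : ℝ) 1 := ⟨Int.fract_nonneg u, (Int.fract_lt_one u).le⟩
    -- mean value inequality on the fibre disc
    have hconv : Convex ℝ (ball (0 : EuclideanSpace ℝ (Fin 2)) (ρ₁ / 2)) := convex_ball _ _
    have hmemU : ∀ m' ∈ ball (0 : EuclideanSpace ℝ (Fin 2)) (ρ₁ / 2), ((u₀, m') : ℝ × EuclideanSpace ℝ (Fin 2)) ∈ U :=
      fun m' hm' => ⟨mem_univ _, mem_ball_zero_iff.2 (by have := mem_ball_zero_iff.1 hm'; linarith)⟩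
    have hnorm : ∀ m' ∈ ball (0 : EuclideanSpace ℝ (Fin 2)) (ρ₁ / 2),
        ‖(fderiv ℝ Sl (u₀, m')).comp (ContinuousLinearMap.inr ℝ ℝ (EuclideanSpace ℝ (Fin 2)))‖ ≤ C := by
      intro m' hm'
      refine le_trans (ContinuousLinearMap.opNorm_comp_le _ _) ?_
      have h1 := hbound u₀ hu₀mem m' (ball_subset_closedBall hm')
      have h2 : ‖ContinuousLinearMap.inr ℝ ℝ (EuclideanSpace ℝ (Fin 2))‖ ≤ 1 := ContinuousLinearMap.norm_inr_le_one ℝ ℝ _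
      nlinarith [norm_nonneg (fderiv ℝ Sl (u₀, m')), norm_nonneg (ContinuousLinearMap.inr ℝ ℝ (EuclideanSpace ℝ (Fin 2)))]
    have hfibW : ∀ m' ∈ ball (0 : EuclideanSpace ℝ (Fin 2)) (ρ₁ / 2),
        HasFDerivWithinAt (fun m'' : EuclideanSpace ℝ (Fin 2) => Sl (u₀, m''))
          ((fderiv ℝ Sl (u₀, m')).comp (ContinuousLinearMap.inr ℝ ℝ (EuclideanSpace ℝ (Fin 2))))
          (ball (0 : EuclideanSpace ℝ (Fin 2)) (ρ₁ / 2)) m' := fun m' hm' =>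
      (hfib (u₀, m') (hmemU m' hm')).hasFDerivWithinAt
    have hmv := hconv.norm_image_sub_le_of_norm_hasFDerivWithin_le hfibW hnorm (mem_ball_self (by linarith))
      (mem_ball_zero_iff.2 hm)
    rw [hSl0, sub_zero, sub_zero, Real.norm_eq_abs] at hmv
    exact hmv
  -- assemble on the belt `ρ' := ρ₁ / 2`
  refine ⟨ρ₁ / 2, C, M, by linarith, by linarith, hC0.le, hMi, fun u m hm => hre u m (by linarith), ?_,
    fun u m hm => ?_, hM, fun u m hm => ?_⟩
  · exact hSl.mono (prod_mono (le_refl _) (ball_subset_ball (by linarith)))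
  · have e : (fun m' : EuclideanSpace ℝ (Fin 2) =>
        (conj (d k) * w g ((bBase g).incl (Ψ ((BoundaryManifold.boundaryData 3 X).restrictDiffeomorph bX G₀.symm
          ((beltMap D k).boundaryTube.toHomeo (circlePt u, m'))))).1).im /
        (conj (d k) * w g ((bBase g).incl (Ψ ((BoundaryManifold.boundaryData 3 X).restrictDiffeomorph bX G₀.symm
          ((beltMap D k).boundaryTube.toHomeo (circlePt u, m'))))).1).re) = fun m' => Sl (u, m') :=
      funext fun m' => (hSl_def (u, m')).symm
    rw [e]
    exact hPn_belt u m (by linarith)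
  · have := hLip u m hm
    rwa [hSl_def] at this

/-- **Sub-goal `helper_beltSlope_uniformBelt` of stub `stub_M2geo`** (N1 ▸ `node_N1_move` ▸ (d) N1-mono, brick H4-7;
wave 7, lead c5; the registered packaging of `beltSlope_uniformBelt`).  On a uniform belt `ℝ × ball 0 ρ'` the belt slope
`Sl (u, m) := S_{d k} (w (Ψ (∂(G₀⁻¹) (β♭ (e^{2πiu}, m)))))` has NON-VANISHING FIBRE DERIVATIVE and satisfies the Lipschitz
bound `|Sl (u, m)| ≤ C ‖m‖`. [cite: EtnyreFuller2006, Thm. 1 (proof, p. 8)] -/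
theorem helper_beltSlope_uniformBelt : ∀ (g n : ℕ) (h : Fin n → Literature.Topology.FourManifolds.HandleAttachingMap 3 2 (Literature.Topology.FourManifolds.LefschetzBase.Base g)) (X₀ : Type) [TopologicalSpace X₀] [ChartedSpace (EuclideanHalfSpace 4) X₀] (bX : Literature.Topology.FourManifolds.BoundaryData (𝓡∂ 4) X₀ (𝓡 3)) (Ψ : bX.carrier ≃ₘ⟮𝓡 3, 𝓡 3⟯ (Literature.Topology.FourManifolds.LefschetzBase.bBase g).carrier) (X : Type) [TopologicalSpace X] [ChartedSpace (EuclideanHalfSpace 4) X] [IsManifold (𝓡∂ 4) ∞ X] (G₀ : X₀ ≃ₘ⟮𝓡∂ 4, 𝓡∂ 4⟯ X) (D : Literature.Topology.FourManifolds.HandleAttachingMap.MultiAttachmentData h (𝓡∂ 4) X) (d : Fin n → ℂ) (k : Fin n), ‖d k‖ = 1 → (∀ θ, (h k).attachingCircle θ ∈ Literature.Topology.FourManifolds.LefschetzBase.page g (d k)) → (∀ (y : bX.carrier) (a : ↥(Literature.Topology.FourManifolds.HandleAttachingMap.coresComplement h)), G₀ (bX.incl y) = D.jA a → ∃ c : ℝ,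 0 < c ∧ Literature.Topology.FourManifolds.LefschetzBase.w g ((Literature.Topology.FourManifolds.LefschetzBase.bBase g).incl (Ψ y)).1 = (c : ℂ) * Literature.Topology.FourManifolds.LefschetzBase.w g (a : Literature.Topology.FourManifolds.LefschetzBase.Base g).1) → (∀ (y : bX.carrier) (j : Fin n) (b : ↥(Literature.Topology.FourManifolds.beltPiece 3 2)), G₀ (bX.incl y) = D.jB j b → G₀ (bX.incl y) ∉ Set.range D.jA → ∃ c : ℝ, 0 < c ∧ Literature.Topology.FourManifolds.LefschetzBase.w g ((Literature.Topology.FourManifolds.LefschetzBase.bBase g).incl (Ψ y)).1 = (c : ℂ) * d j) → ∃ (ρ' C : ℝ), 0 < ρ' ∧ 0 ≤ C ∧ (∀ (u : ℝ) (m : EuclideanSpace ℝ (Fin 2)), ‖m‖ < ρ' → fderiv ℝ (fun m' : EuclideanSpace ℝ (Fin 2) => ((starRingEnd ℂ) (d k) * Literature.Topology.FourManifolds.LefschetzBase.w g ((Literature.Topology.FourManifolds.LefschetzBase.bBase g).incl (Ψ ((Literature.Topology.FourManifolds.BoundaryManifold.boundaryData 3 X).restrictDiffeomorph bX G₀.symm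 ((Summit.SmoothPoincare4.SmoothPoincare4.Theorems.AcyclicBisectionExists.ModpBraidOrbits.beltMap D k).boundaryTube.toHomeo (Literature.Topology.FourManifolds.circlePt u, m'))))).1).im / ((starRingEnd ℂ) (d k) * Literature.Topology.FourManifolds.LefschetzBase.w g ((Literature.Topology.FourManifolds.LefschetzBase.bBase g).incl (Ψ ((Literature.Topology.FourManifolds.BoundaryManifold.boundaryData 3 X).restrictDiffeomorph bX G₀.symm ((Summit.SmoothPoincare4.SmoothPoincare4.Theorems.AcyclicBisectionExists.ModpBraidOrbits.beltMap D k).boundaryTube.toHomeo (Literature.Topology.FourManifolds.circlePt u, m'))))).1).re) m ≠ 0) ∧ (∀ (u : ℝ) (m : EuclideanSpace ℝ (Fin 2)), ‖m‖ < ρ' → |((starRingEnd ℂ) (d k) * Literature.Topology.FourManifolds.LefschetzBase.w g ((Literature.Topology.FourManifolds.LefschetzBase.bBase g).incl (Ψ ((Literature.Topology.FourManifolds.BoundaryManifold.boundaryData 3 X).restrictDiffeomorph bX G₀.symm ((Summit.SmoothPoincare4.SmoothPoincare4.Theorems.AcyclicBisectionExists.ModpBraidOrbits.beltMap D k).boundaryTube.toHomeo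 (Literature.Topology.FourManifolds.circlePt u, m))))).1).im / ((starRingEnd ℂ) (d k) * Literature.Topology.FourManifolds.LefschetzBase.w g ((Literature.Topology.FourManifolds.LefschetzBase.bBase g).incl (Ψ ((Literature.Topology.FourManifolds.BoundaryManifold.boundaryData 3 X).restrictDiffeomorph bX G₀.symm ((Summit.SmoothPoincare4.SmoothPoincare4.Theorems.AcyclicBisectionExists.ModpBraidOrbits.beltMap D k).boundaryTube.toHomeo (Literature.Topology.FourManifolds.circlePt u, m))))).1).re| ≤ C * ‖m‖) := by
  intro g n h X₀ _ _ bX Ψ X _ _ _ G₀ D d k hd hcore hseam hbelt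
  obtain ⟨ρ', C, M, hρ', -, hC0, -, -, -, hfd, -, hLip⟩ := beltSlope_uniformBelt bX Ψ G₀ D d k hd hcore hseam hbelt
  exact ⟨ρ', C, hρ', hC0, hfd, hLip⟩

end Belt

end Summit.SmoothPoincare4.SmoothPoincare4.Theorems.AcyclicBisectionExists.ModpBraidOrbits

end
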